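import Literature.Barriers.SmoothPoincare4.PropertyTwoRAndrewsCurtisProofs
import HarnessLib

/-!
# Barrier `StrictPropertyTwoRBarrier` (Gompf–Scharlemann–Thompson §7): the one geometric leaf — GST's link — named, and the assembly

Barrier catalogue `Literature/Barriers/SmoothPoincare4/` (D-0021). Fact-decomposition record
(librarian, fact-decompose, 2026-08-16) for the barrier
`Literature.Barriers.SmoothPoincare4.StrictPropertyTwoRBarrier`
(`AKPresentationsACNontrivial → ¬ StrictPropertyTwoRConjecture`; R. E. Gompf, M. Scharlemann,
A. Thompson, *Fibered knots and potential counterexamples to the Property 2R and Slice-Ribbon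
Conjectures*, Geom. Topol. 14 (2010), §7), an XL fact that ran to the prover budget cap. By
`strictPropertyTwoRBarrier_iff_gst` (`PropertyTwoRAndrewsCurtisProofs.lean`) the barrier is
EQUIVALENT to GST's §7 implication "printed Property 2R ⇒ every `⟨x, y ∣ yxy = xyx, xⁿ⁺¹ = yⁿ⟩` is
Andrews–Curtis trivial", whose printed proof (arXiv p. 17) is ONE sentence about ONE link:

> "If the 2-component link `L_{n,k}` of Figure 11 … can be changed to the unlink by handle slides,
> then the dual slides in Figure 9 will trivialize that picture, showing that the above presentation
> is Andrews–Curtis trivial. … Since surgery on `L_{n,k}` is `#²(S¹ × S²)` by construction, …"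

That sentence — the existence, for each `n`, of a `2`-component framed link whose surgery is
`#²(S² × S¹)` and which has the property "strictly handle-slide equivalent to a `0`-framed unlink ⇒
`gstPresentation n` is Andrews–Curtis trivial" — is named here as the ONE child
`gst2010_link_acTrivial_of_slides`. It is NOT the barrier reworded: the barrier (equivalently the
§7 implication) is `(∀ L with surgery #², L slides to an unlink) → ∀ n, AC-trivial`, an
implication whose hypothesis ranges over all links; the child asserts, for each `n`, the EXISTENCE
of GST's link `L_{n,1}` (square knot `Q` interleaved with `Vₙ = T_{n,n+1} # T̄_{n,n+1}`, Figure 11,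
with its `0`-framed surgery identified with `#²(S¹ × S²)` through Gompf's Kirby calculus [Go1]) and
the per-link mechanism of §7 (the meridian presentation of `π₁` of the surgered manifold read off
Gompf's diagram is `⟨x, y ∣ y = w⁻¹xw, xⁿ⁺¹ = yⁿ⟩`, `w = yx`; a 2-handle slide changes the
meridian relators by an Andrews–Curtis move, "the dual slide"; the unlink gives the trivial
presentation; changes of free basis do not affect Andrews–Curtis TRIVIALITY —
`BalancedPresentationBasisChange.lean`). The two halves of that mechanism — (a) existence and
surgery of `L_{n,1}`, (b) the Andrews–Curtis invariance of meridian presentations under STRICT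
slides — share the notion "meridian presentation of a framed link whose surgery is `#ⁿ(S¹ × S²)`",
which the tree cannot yet define (its bricks are being laid by the fact seat:
`DehnSurgeryLinkFundamentalGroup.lean`, `LinkGroupMeridians.lean`,
`SphereTwoProdCircleSumFundamentalGroup.lean`, `KirbyMovesSlideModel.lean`); once it exists, this
child splits further into (a) and (b) with (b) a theorem about all links. For `n ≤ 2` the
conclusion of the child holds outright (`isAndrewsCurtisEquivalent_gstPresentation_trivial_of_le_two`,
GST §8), so any `2`-component framed link with surgery `#²(S² × S¹)` witnesses it there.

The assembly `StrictPropertyTwoRBarrier_holds_of` is `strictPropertyTwoRBarrier_of_gst` fed with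
the §7 implication obtained from the child by applying the printed Property 2R to GST's link.

## References

* [GompfScharlemannThompson2010] R. E. Gompf, M. Scharlemann, A. Thompson, Geom. Topol. 14 (2010)
  2305–2347 (arXiv:1103.1601): §1 (p. 2), §2 Conjecture 1, §7 (arXiv pp. 16–17, Figures 9, 11),
  §8, and [Go1] = Gompf 1991.
* [Gompf1991Killing] R. E. Gompf, *Killing the Akbulut–Kirby 4-sphere, with relevance to the
  Andrews–Curtis and Schoenflies problems*, Topology 30 (1991), handle diagram.
* [Kirby1997] R. Kirby, *Problems in low-dimensional topology* (1997), Problem 1.82.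
-/

noncomputable section

open scoped Manifold ContDiff

namespace Literature.Barriers.SmoothPoincare4

open Literature.Topology.FourManifolds

variable [SphereEmbedding.SmoothnessFacts] [Knot.TubularNbhd.SmoothnessFacts]

/-! ### GST's link, named -/

/-- **Gompf–Scharlemann–Thompson 2010, §7 (with §1 and [Go1]): for every `n` there is a
`2`-component framed link in `S³` — GST's `L_{n,1}` — whose surgery is `(S² × S¹) # (S² × S¹)`
and which can be strictly handle-slid to a `0`-framed unlink ONLY IF the presentation
`⟨x, y ∣ yxy = xyx, xⁿ⁺¹ = yⁿ⟩` is Andrews–Curtis trivial.** Formally: for every `n : ℕ` there is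
`L : FramedLink (Fin 2)` such that (i) some closed connected smooth `3`-manifold `Y` with
`IsSphereTwoProdCircleSum 2 Y` is the surgery on `L` (`L.IsSurgery (𝓡 3) Y`) — "surgery on
`L_{n,k}` is `#²(S¹ × S²)` by construction" (§7; §1: `L_{n,1} = Q ⊔ Vₙ`, the square knot
interleaved with `T_{n,n+1} # T̄_{n,n+1}`, Figure 11, and Gompf's Kirby calculus [Go1]) — and
(ii) for every `0`-framed unlink `U` (`FramedLink.IsZeroFramedUnlink`), if `L` and `U` are related
by strict handle slides (`IsStrictHandleSlideEquivalent`, the printed 2-handle slides of §2: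
isotopies, renumbering, orientation reversal and `FramedLink.IsStrictHandleSlide`) then
`gstPresentation n` is Andrews–Curtis equivalent to the trivial presentation — "If the 2-component
link `L_{n,k}` … can be changed to the unlink by handle slides, then the dual slides in Figure 9
will trivialize that picture, showing that the above presentation [`⟨x, y ∣ y = w⁻¹xw, xⁿ⁺¹ = yⁿ⟩`,
`w = yx` for `k = 1`] is Andrews–Curtis trivial" (§7, arXiv p. 17; mechanism: the meridians of `L`
give relators of a balanced presentation of the trivial group on a free basis of
`π₁(#²(S¹ × S²)) = F₂`, a 2-handle slide multiplies a relator by a conjugate of the other — the dual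
slide, an Andrews–Curtis move — and the unlink gives the trivial presentation; Andrews–Curtis
TRIVIALITY is insensitive to the free basis, `BalancedPresentationBasisChange.lean`). Only `k = 1`
is rendered (`gstPresentation`). For `n ≤ 2` clause (ii) holds for every link, the presentation
being Andrews–Curtis trivial outright (§8; `isAndrewsCurtisEquivalent_gstPresentation_trivial_of_le_two`).
[cite: GompfScharlemannThompson2010, §7 (arXiv p. 17, Figures 9 and 11), §1 (p. 2: L_{n,1} and its surgery), §2 (handle slides), §8]
[cite: Gompf1991Killing, handle diagram (GST's [Go1])] -/
def gst2010_link_acTrivial_of_slides : Prop :=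
  ∀ n : ℕ, ∃ L : FramedLink (Fin 2),
    (∃ (Y : Type) (_ : TopologicalSpace Y) (_ : T2Space Y) (_ : SecondCountableTopology Y)
        (_ : ChartedSpace (EuclideanSpace ℝ (Fin 3)) Y) (_ : IsManifold (𝓡 3) ∞ Y)
        (_ : CompactSpace Y) (_ : ConnectedSpace Y),
        IsSphereTwoProdCircleSum 2 Y ∧ L.IsSurgery (𝓡 3) Y) ∧
    ∀ U : FramedLink (Fin 2), U.IsZeroFramedUnlink →
      IsStrictHandleSlideEquivalent ⟨2, L⟩ ⟨2, U⟩ →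
        IsAndrewsCurtisEquivalent (gstPresentation n) (BalancedPresentation.trivial 2)

/-! ### The §7 implication and the barrier from the child -/

/-- **GST's §7 implication from GST's link**: given `gst2010_link_acTrivial_of_slides`, the printed
Property 2R (`StrictPropertyTwoRConjecture`) forces Andrews–Curtis triviality of every
`⟨x, y ∣ yxy = xyx, xⁿ⁺¹ = yⁿ⟩` — apply Property 2R to `L_{n,1}` and its surgery.
[cite: GompfScharlemannThompson2010, §7] -/
theorem gst2010_strictPropertyTwoR_andrewsCurtis_of_link (h : gst2010_link_acTrivial_of_slides)
    (h2R : StrictPropertyTwoRConjecture) (n : ℕ) :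
    IsAndrewsCurtisEquivalent (gstPresentation n) (BalancedPresentation.trivial 2) := by
  obtain ⟨L, ⟨Y, _, _, _, _, _, _, _, hY, hL⟩, hAC⟩ := h n
  obtain ⟨U, hU, hLU⟩ := h2R L Y hY hL
  exact hAC U hU hLU

/-- **The barrier `StrictPropertyTwoRBarrier` from its one named leaf** (fact-decomposition glue,
canonical name): `strictPropertyTwoRBarrier_of_gst` fed with the §7 implication obtained from GST's
link (`gst2010_strictPropertyTwoR_andrewsCurtis_of_link`). [cite: GompfScharlemannThompson2010, §1 p. 2 and §7] -/
theorem StrictPropertyTwoRBarrier_holds_of (h : gst2010_link_acTrivial_of_slides) :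
    StrictPropertyTwoRBarrier :=
  strictPropertyTwoRBarrier_of_gst (gst2010_strictPropertyTwoR_andrewsCurtis_of_link h)

end Literature.Barriers.SmoothPoincare4

end
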